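import Summits.QuantumFields.YangMills.Theorems.VirialFluxGapResolventFieldPointwise
import HarnessLib

/-!
# Route `VirialFluxGap` (YangMills): the RESOLVENT EULER FIELD — the GENERIC-REGION MASTER ESTIMATES at a point

Toward the deciding crux `VirialFluxGap.PeriodicSoftness` (item stmt-QuantumFields-24141), generic-region Euler field `X_g = ½(H+λ⋆)⁻¹g`
(memo `fcl-p3-g40-RESOLVENT-EULER-FIELD-24141.md`).  This file COMPOSES the landed layers — ✓`ResolventField.drive_lower_of_taylor`,
✓`ResolventField.divergence_upper` (linear algebra), ✓`FrameHessian.pointwise_taylor_package` (Taylor letters in a frame family `τ_j`) — into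
the two pointwise estimates of the «EulerField» hypothesis at a point `P` of the ring space, from exactly four inputs:
(i) a frame family `τ_j` with slot norms `≤ 1`; (ii) coordinates `u` such that `p = P·exp(Σ u_jτ_j)` is a ZERO of `F₀` with the QUADRATIC
GROWTH `κ|u|² ≤ F₀(P)`; (iii) an orthonormal KERNEL FAMILY of the raw frame Hessian at `p` (`m` vectors); (iv) ONE constant `K` bounding all
third frame derivatives of `ringPoly` trilinearly in the slot norms (✓`exists_bound_frameD3_ringPoly`: `K = C·L⁴`).

* §1 letters: slot norm of `Y_u` (`≤ ‖u‖₁ ≤ √#ι·|u|`), the sup bounds `K₁ ≤ K‖u‖₁`, `K₂ ≤ K‖u‖₁²`, `K₃ ≤ K‖u‖₁³`;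
* §2 ★★★ `generic_drive_lower` — with `A = H(P) + λ⋆`, `H = frameHess`, `g = frameGrad`, `|u|² = u·u`, `ℓ = Σ|u_j|`, under the
  smallness `K·ℓ·#ι ≤ λ⋆/2`:  `(1 − η − (3K#ι^{3/2}|u| + λ⋆/2 + 4K²#ι³|u|²/(ηλ⋆))/κ)·F₀(P) ≤ ½gᵀA⁻¹g`;
* §3 ★★★ `generic_divergence_upper` — for any matrices `B_i` with `|B_iv|² ≤ b²|v|²` (in the assembly: the frame derivatives of the Hessian
  entries, `b = #ι·K`): `½tr(A⁻¹H) − ½Σ_i(A⁻¹B_iA⁻¹g)_i ≤ ½(#ι − m) + ½·m·s/(s+λ⋆) + ½·#ι·(2b/λ⋆)·√(3(5d² + 4M²d⁴/λ⋆²))`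
  with `s = K#ι^{3/2}d·#ι`, `M = 2K#ι^{3/2}`.

With `#ι − m = 18L⁴ − 3`, `λ⋆ = κ·o(L⁻⁴)` and `d ≤ √(t₀/κ)`, `t₀ = 1/poly(L)` these are the clauses (i)/(ii) of «EulerField» on the generic
region (in w3's normalisation `X = 2X_g`).  What is NOT here: the existence of `u` (SU(2)-logarithm + w2's regular-valley Łojasiewicz), the
kernel family (comb parametrisation of the valley), the cut-offs and central charts, the regularity clauses and the identification
`Σ_i∂_iφ_i = ½tr(A⁻¹H) − ½Σ_i(A⁻¹B_iA⁻¹g)_i` along the frame curves (✓`sum_deriv_resolvent_coeff` ∘ ✓`hasDerivAt_resolvent_coeff`).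

HONEST FRAMING: composition of landed helper lemmas; ⟨24141⟩ stays OPEN; no stub / crux / rung / summit is closed; the Yang–Mills mass gap is
NOT proved; no summit is proved by a line.  THEOREMS ONLY (0 `def`, 0 `sorry`), standard axioms.  Explicit-unit seat `ym-line-fcl-p3` g40
(cell ym-idea-1, free hands), `--supports stmt-QuantumFields-24141`.  References: [folklore].
-/

set_option autoImplicit false

noncomputable section

open scoped Matrix BigOperators ContDiff Topology
open MeasureTheory Set Matrix
open Literature.MathematicalPhysics.QuantumFieldTheory hiding SU2
open Literature.MathematicalPhysics.QuantumLattice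
open Literature.MathematicalPhysics.QuantumFieldTheory.SUNBakryEmery (expSU coe_expSU matTop)

namespace Summit.QuantumFields.YangMills.Theorems.VirialFluxGap.FrameHessian

open Summit.QuantumFields.YangMills.Theorems.FemtoTransferGap
open Summit.QuantumFields.YangMills.Theorems.FemtoTransferGap.TT
open Summit.QuantumFields.YangMills.Theorems.VirialFluxGap.RingDeficit
open Summit.QuantumFields.YangMills.Theorems.VirialFluxGap.FrameDerivative
open Summit.QuantumFields.YangMills.Theorems.VirialFluxGap.ResolventField

variable {L : ℕ} [NeZero L]
variable {ι : Type*} [Fintype ι]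

open scoped Matrix.Norms.Frobenius

attribute [local instance 2000] Literature.MathematicalPhysics.QuantumFieldTheory.SUNBakryEmery.matTop

/-! ## §1 Letters: slot norms of `Y_u`, `ℓ¹` versus `ℓ²` -/

omit [NeZero L] in
/-- Slot norms of `Y_u = Σ_j u_j τ_j`: `‖Y_u(w)‖ ≤ Σ_j |u_j|` when every `‖τ_j(w)‖ ≤ 1`. [folklore] -/
theorem norm_dirOf_le {τ : ι → ((Fin (2 * L - 1 + 1) × Edge 3 L) ⊕ Site 3 L) → Matrix (Fin 2) (Fin 2) ℂ} (hτn : ∀ j w, ‖τ j w‖ ≤ 1) (u : ι → ℝ) (w : ((Fin (2 * L - 1 + 1) × Edge 3 L) ⊕ Site 3 L)) :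
    ‖dirOf τ u w‖ ≤ ∑ j, |u j| := by
  rw [dirOf, Finset.sum_apply]
  refine (norm_sum_le _ _).trans (Finset.sum_le_sum fun j _ => ?_)
  rw [Pi.smul_apply, norm_smul, Real.norm_eq_abs]
  calc |u j| * ‖τ j w‖ ≤ |u j| * 1 := mul_le_mul_of_nonneg_left (hτn j w) (abs_nonneg _)
    _ = |u j| := mul_one _

omit [NeZero L] in
/-- `ℓ¹ ≤ √#ι · ℓ²`: `(Σ|u_j|)² ≤ #ι · Σ u_j²`. [folklore] -/
theorem sum_abs_sq_le (u : ι → ℝ) : (∑ j, |u j|) ^ 2 ≤ Fintype.card ι * (u ⬝ᵥ u) := by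
  have h := sq_sum_le_card_mul_sum_sq (s := Finset.univ) (f := fun j => |u j|)
  simp only [Finset.card_univ, sq_abs] at h
  have e : u ⬝ᵥ u = ∑ j, u j ^ 2 := by simp [dotProduct, sq]
  rw [e]; exact h

/-! ## §2 The driving estimate on the generic region -/

omit [Fintype ι] in
/-- The symmetrised Hessian equals the raw one where the raw one is symmetric (e.g. at a zero). [folklore] -/
theorem frameHess_eq_raw_of_symm (τ : ι → ((Fin (2 * L - 1 + 1) × Edge 3 L) ⊕ Site 3 L) → Matrix (Fin 2) (Fin 2) ℂ) (M : ((Fin (2 * L - 1 + 1) → Edge 3 L → Matrix (Fin 2) (Fin 2) ℂ) × (Site 3 L → Matrix (Fin 2) (Fin 2) ℂ)))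
    (hsymm : (frameHessRaw (L := L) τ M)ᵀ = frameHessRaw (L := L) τ M) : frameHess (L := L) τ M = frameHessRaw (L := L) τ M := by
  ext j k
  have h := congr_fun (congr_fun hsymm j) k
  rw [Matrix.transpose_apply] at h
  simp only [frameHess, h]
  ring

/-- ★★★ **GENERIC-REGION DRIVING ESTIMATE.**  Frame family with unit slot norms, `p = P·exp(Y_u)` a zero of `F₀`, quadratic growth
`κ|u|² ≤ F₀(P)`, trilinear third-derivative bound `K`, parameters `λ⋆ > 0`, `0 < η < 1`, and the smallness `K·ℓ·#ι ≤ λ⋆/2` where `ℓ = Σ|u_j|`: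
then `(1 − η − (3K#ι^{3/2}·|u| + λ⋆/2 + 4K²#ι³|u|²/(ηλ⋆))/κ)·F₀(P) ≤ ½gᵀ(H + λ⋆)⁻¹g` (all at `ringCoord P`, `|u| = √(u·u)`; the error is
`o(L⁻⁴)` once `λ⋆ ≪ κL⁻⁴` and `|u| ≪ ηκ/(K#ι³L⁴)`). [folklore] -/
theorem generic_drive_lower {τ : ι → ((Fin (2 * L - 1 + 1) × Edge 3 L) ⊕ Site 3 L) → Matrix (Fin 2) (Fin 2) ℂ} (hτ : ∀ j w, (τ j w)ᴴ = -τ j w) (hτ0 : ∀ j w, (τ j w).trace = 0)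
    (hτn : ∀ j w, ‖τ j w‖ ≤ 1) [DecidableEq ι] (u : ι → ℝ) (P : ((Fin (2 * L - 1 + 1) → GaugeConfig 3 L SU2) × (Site 3 L → SU2)))
    (hp : ringDeficit L (fun _ => false) (P * multiCurve (dirOf τ u) (dirOf_conjTranspose hτ u) (dirOf_trace hτ0 u) 1) = 0)
    {K κ lam η : ℝ} (hK : 0 ≤ K) (hκ : 0 < κ) (hlam : 0 < lam) (hη : 0 < η) (hη1 : η < 1)
    (hK3 : ∀ (Y₁ Y₂ Y₃ : ((Fin (2 * L - 1 + 1) × Edge 3 L) ⊕ Site 3 L) → Matrix (Fin 2) (Fin 2) ℂ) (b₁ b₂ b₃ : ℝ), 0 ≤ b₁ → 0 ≤ b₂ → 0 ≤ b₃ →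
      (∀ w, ‖Y₁ w‖ ≤ b₁) → (∀ w, ‖Y₂ w‖ ≤ b₂) → (∀ w, ‖Y₃ w‖ ≤ b₃) → ∀ Q : ((Fin (2 * L - 1 + 1) → GaugeConfig 3 L SU2) × (Site 3 L → SU2)),
      |frameD Y₁ (frameD Y₂ (frameD Y₃ (ringPoly L))) (ringCoord L Q)| ≤ K * b₁ * b₂ * b₃)
    (hqg : κ * (u ⬝ᵥ u) ≤ ringDeficit L (fun _ => false) P)
    (hsmall : K * (∑ j, |u j|) * Fintype.card ι ≤ lam / 2) :
    (1 - η - (3 * K * ((Fintype.card ι : ℝ) * Real.sqrt (Fintype.card ι)) * Real.sqrt (u ⬝ᵥ u) + lam / 2 +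
        4 * K ^ 2 * (Fintype.card ι : ℝ) ^ 3 * (u ⬝ᵥ u) / (η * lam)) / κ) * ringDeficit L (fun _ => false) P ≤
      (1 / 2) * (frameGrad (L := L) τ (ringCoord L P) ⬝ᵥ
        ((frameHess (L := L) τ (ringCoord L P) + lam • (1 : Matrix ι ι ℝ))⁻¹ *ᵥ frameGrad (L := L) τ (ringCoord L P))) := by
  classical
  set ℓ := ∑ j, |u j| with hℓ
  have hℓ0 : 0 ≤ ℓ := Finset.sum_nonneg fun j _ => abs_nonneg _
  set M := ringCoord L P with hM
  set g := frameGrad (L := L) τ M with hg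
  set H := frameHess (L := L) τ M with hH
  set r := g + H *ᵥ u with hr
  set F := ringDeficit L (fun _ => false) P with hF
  -- the sup bounds from the trilinear `K`
  have hYu : ∀ w, ‖dirOf τ u w‖ ≤ ℓ := fun w => norm_dirOf_le hτn u w
  have hK1 : ∀ j k (Q : ((Fin (2 * L - 1 + 1) → GaugeConfig 3 L SU2) × (Site 3 L → SU2))), |frameD (dirOf τ u) (frameD (τ j) (frameD (τ k) (ringPoly L))) (ringCoord L Q)| ≤ K * ℓ := by
    intro j k Q
    have h := hK3 (dirOf τ u) (τ j) (τ k) ℓ 1 1 hℓ0 zero_le_one zero_le_one hYu (hτn j) (hτn k) Q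
    simpa using h
  have hK2 : ∀ k (Q : ((Fin (2 * L - 1 + 1) → GaugeConfig 3 L SU2) × (Site 3 L → SU2))), |frameD (dirOf τ u) (frameD (dirOf τ u) (frameD (τ k) (ringPoly L))) (ringCoord L Q)| ≤ K * ℓ ^ 2 := by
    intro k Q
    have h := hK3 (dirOf τ u) (dirOf τ u) (τ k) ℓ ℓ 1 hℓ0 hℓ0 zero_le_one hYu hYu (hτn k) Q
    calc _ ≤ K * ℓ * ℓ * 1 := h
      _ = K * ℓ ^ 2 := by ring
  have hK3' : ∀ Q : ((Fin (2 * L - 1 + 1) → GaugeConfig 3 L SU2) × (Site 3 L → SU2)), |frameD (dirOf τ u) (frameD (dirOf τ u) (frameD (dirOf τ u) (ringPoly L))) (ringCoord L Q)| ≤ K * ℓ ^ 3 := by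
    intro Q
    have h := hK3 (dirOf τ u) (dirOf τ u) (dirOf τ u) ℓ ℓ ℓ hℓ0 hℓ0 hℓ0 hYu hYu hYu Q
    calc _ ≤ K * ℓ * ℓ * ℓ := h
      _ = K * ℓ ^ 3 := by ring
  obtain ⟨hc1, hc2, ⟨hsymm, hpsd⟩, hc4⟩ := pointwise_taylor_package hτ hτ0 u P hp hK1 hK2 hK3'
  -- the floor `c = λ⋆/2` from the drift `K ℓ` and the smallness
  have hKℓ : 0 ≤ K * ℓ := mul_nonneg hK hℓ0
  set p := P * multiCurve (dirOf τ u) (dirOf_conjTranspose hτ u) (dirOf_trace hτ0 u) 1 with hpdef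
  have hHp : frameHess (L := L) τ (ringCoord L p) = frameHessRaw (L := L) τ (ringCoord L p) :=
    frameHess_eq_raw_of_symm τ _ hsymm
  have hdrift : ∀ j k, |H j k - frameHessRaw (L := L) τ (ringCoord L p) j k| ≤ K * ℓ := by
    intro j k; rw [← hHp]; exact hc4 j k
  have hfl : ∀ v, (lam / 2) * (v ⬝ᵥ v) ≤ v ⬝ᵥ ((H + lam • (1 : Matrix ι ι ℝ)) *ᵥ v) := by
    intro v
    have h := floor_of_drift (lam := lam) hKℓ hdrift hpsd v
    have hcard : K * ℓ * Fintype.card ι ≤ lam / 2 := hsmall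
    have hvv : 0 ≤ v ⬝ᵥ v := Finset.sum_nonneg fun i _ => mul_self_nonneg (v i)
    nlinarith
  -- Taylor data for `drive_lower_of_taylor`
  have hHsymm : Hᵀ = H := frameHess_transpose τ M
  have hgr : g = r - H *ᵥ u := by rw [hr]; abel
  set d := Real.sqrt (u ⬝ᵥ u) with hd
  have huu0 : 0 ≤ u ⬝ᵥ u := Finset.sum_nonneg fun i _ => mul_self_nonneg (u i)
  have hd0 : 0 ≤ d := Real.sqrt_nonneg _
  have hd2 : d ^ 2 = u ⬝ᵥ u := Real.sq_sqrt huu0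
  have hℓd : ℓ ^ 2 ≤ Fintype.card ι * d ^ 2 := by rw [hd2]; exact sum_abs_sq_le u
  have hℓd' : ℓ ≤ Real.sqrt (Fintype.card ι) * d := by
    have h0 : 0 ≤ Real.sqrt (Fintype.card ι) * d := by positivity
    have : ℓ ^ 2 ≤ (Real.sqrt (Fintype.card ι) * d) ^ 2 := by
      rw [mul_pow, Real.sq_sqrt (by positivity)]; exact hℓd
    exact (pow_le_pow_iff_left₀ hℓ0 h0 two_ne_zero).1 this
  -- `ρ₃ := F − (½uHu − r u)`, `|ρ₃| ≤ K ℓ³`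
  set ρ₃ := F - ((1 / 2) * (u ⬝ᵥ (H *ᵥ u)) - r ⬝ᵥ u) with hρ₃
  have hFeq : F = (1 / 2) * (u ⬝ᵥ (H *ᵥ u)) - r ⬝ᵥ u + ρ₃ := by rw [hρ₃]; ring
  have hρ : |ρ₃| ≤ K * ℓ ^ 3 := hc1
  -- `|r_k| ≤ Kℓ² + Kℓ·ℓ = 2Kℓ²`, so `r⬝r ≤ #ι (2Kℓ²)²`
  have hrk : ∀ k, |r k| ≤ 2 * K * ℓ ^ 2 := by
    intro k
    have h := hc2 k
    calc |r k| ≤ K * ℓ ^ 2 + K * ℓ * ℓ := h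
      _ = 2 * K * ℓ ^ 2 := by ring
  have hrr : r ⬝ᵥ r ≤ Fintype.card ι * (2 * K * ℓ ^ 2) ^ 2 := by
    calc r ⬝ᵥ r = ∑ k, r k * r k := rfl
      _ ≤ ∑ _k : ι, (2 * K * ℓ ^ 2) ^ 2 := Finset.sum_le_sum fun k _ => by
          have h := hrk k
          have h0 : 0 ≤ 2 * K * ℓ ^ 2 := by positivity
          rw [← sq, ← sq_abs]
          exact pow_le_pow_left₀ (abs_nonneg _) h 2
      _ = Fintype.card ι * (2 * K * ℓ ^ 2) ^ 2 := by simp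
  -- convert the `ℓ`-bounds into `d`-bounds: `ℓ ≤ √#ι d`
  set Mr : ℝ := 2 * K * (Fintype.card ι : ℝ) * Real.sqrt (Fintype.card ι) with hMr
  set M₃ : ℝ := K * (Fintype.card ι : ℝ) * Real.sqrt (Fintype.card ι) with hM₃
  have hsq : Real.sqrt (Fintype.card ι) ^ 2 = Fintype.card ι := Real.sq_sqrt (by positivity)
  have hMr2 : Mr ^ 2 = 4 * K ^ 2 * (Fintype.card ι : ℝ) ^ 3 := by
    have : Mr ^ 2 = (2 * K * (Fintype.card ι : ℝ)) ^ 2 * Real.sqrt (Fintype.card ι) ^ 2 := by rw [hMr]; ring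
    rw [this, hsq]; ring
  have hrr' : r ⬝ᵥ r ≤ Mr ^ 2 * d ^ 4 := by
    have h1 : ℓ ^ 2 ≤ Fintype.card ι * d ^ 2 := hℓd
    have h2 : (ℓ ^ 2) ^ 2 ≤ (Fintype.card ι * d ^ 2) ^ 2 := pow_le_pow_left₀ (by positivity) h1 2
    calc r ⬝ᵥ r ≤ Fintype.card ι * (2 * K * ℓ ^ 2) ^ 2 := hrr
      _ = Fintype.card ι * (2 * K) ^ 2 * (ℓ ^ 2) ^ 2 := by ring
      _ ≤ Fintype.card ι * (2 * K) ^ 2 * (Fintype.card ι * d ^ 2) ^ 2 := by gcongr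
      _ = Mr ^ 2 * d ^ 4 := by rw [hMr2]; ring
  have hρ' : |ρ₃| ≤ M₃ * d ^ 3 := by
    have h1 : ℓ ^ 3 ≤ (Real.sqrt (Fintype.card ι) * d) ^ 3 := pow_le_pow_left₀ hℓ0 hℓd' 3
    calc |ρ₃| ≤ K * ℓ ^ 3 := hρ
      _ ≤ K * (Real.sqrt (Fintype.card ι) * d) ^ 3 := mul_le_mul_of_nonneg_left h1 hK
      _ = M₃ * d ^ 3 := by
          rw [hM₃, mul_pow]
          have : Real.sqrt (Fintype.card ι) ^ 3 = Fintype.card ι * Real.sqrt (Fintype.card ι) := by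
            rw [pow_succ, hsq]
          rw [this]; ring
  have hqg' : κ * d ^ 2 ≤ F := by rw [hd2]; exact hqg
  have hdrive := drive_lower_of_taylor hHsymm hlam.le (by positivity : (0 : ℝ) < lam / 2) hη hη1 hκ hfl hgr hd0
    (by positivity : 0 ≤ Mr) (by positivity : 0 ≤ M₃) hFeq (le_of_eq hd2.symm) hrr' hρ' hqg'
  -- rewrite the error expression of `drive_lower_of_taylor` in closed form
  have hE : (Mr + M₃) * d + lam / 2 + Mr ^ 2 * d ^ 2 / (2 * η * (lam / 2)) =
      3 * K * ((Fintype.card ι : ℝ) * Real.sqrt (Fintype.card ι)) * d + lam / 2 +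
        4 * K ^ 2 * (Fintype.card ι : ℝ) ^ 3 * (u ⬝ᵥ u) / (η * lam) := by
    rw [hMr2, hd2]
    have h1 : (Mr + M₃) * d = 3 * K * ((Fintype.card ι : ℝ) * Real.sqrt (Fintype.card ι)) * d := by rw [hMr, hM₃]; ring
    have h2 : (2 : ℝ) * η * (lam / 2) = η * lam := by ring
    rw [h1, h2]
  rw [hE] at hdrive
  exact hdrive

/-! ## §3 The divergence estimate on the generic region -/

/-- ★★★ **GENERIC-REGION DIVERGENCE ESTIMATE.**  Same data as `generic_drive_lower`, plus an orthonormal KERNEL FAMILY `k_a` (`a : Fin m`)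
of the raw frame Hessian at the zero `p` and matrices `B_i` with `|B_iv|² ≤ b²|v|²` (in the assembly: the frame derivatives of the Hessian
entries, `b = #ι·K`).  Then, with `s = K·ℓ·#ι` (`ℓ = Σ|u_j|`) and `M = 2K#ι^{3/2}`:
`½tr(A⁻¹H) − ½Σ_i(A⁻¹B_iA⁻¹g)_i ≤ ½(#ι − m) + ½·m·s/(s+λ⋆) + ½·#ι·(b/(λ⋆/2))·√(3((1 + λ⋆²/(λ⋆/2)²)|u|² + M²|u|⁴/(λ⋆/2)²))`. [folklore] -/
theorem generic_divergence_upper {τ : ι → ((Fin (2 * L - 1 + 1) × Edge 3 L) ⊕ Site 3 L) → Matrix (Fin 2) (Fin 2) ℂ} (hτ : ∀ j w, (τ j w)ᴴ = -τ j w)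
    (hτ0 : ∀ j w, (τ j w).trace = 0) (hτn : ∀ j w, ‖τ j w‖ ≤ 1) [DecidableEq ι] (u : ι → ℝ) (P : ((Fin (2 * L - 1 + 1) → GaugeConfig 3 L SU2) × (Site 3 L → SU2)))
    (hp : ringDeficit L (fun _ => false) (P * multiCurve (dirOf τ u) (dirOf_conjTranspose hτ u) (dirOf_trace hτ0 u) 1) = 0)
    {K lam : ℝ} (hK : 0 ≤ K) (hlam : 0 < lam)
    (hK3 : ∀ (Y₁ Y₂ Y₃ : ((Fin (2 * L - 1 + 1) × Edge 3 L) ⊕ Site 3 L) → Matrix (Fin 2) (Fin 2) ℂ) (b₁ b₂ b₃ : ℝ), 0 ≤ b₁ → 0 ≤ b₂ → 0 ≤ b₃ →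
      (∀ w, ‖Y₁ w‖ ≤ b₁) → (∀ w, ‖Y₂ w‖ ≤ b₂) → (∀ w, ‖Y₃ w‖ ≤ b₃) → ∀ Q : ((Fin (2 * L - 1 + 1) → GaugeConfig 3 L SU2) × (Site 3 L → SU2)),
      |frameD Y₁ (frameD Y₂ (frameD Y₃ (ringPoly L))) (ringCoord L Q)| ≤ K * b₁ * b₂ * b₃)
    (hsmall : K * (∑ j, |u j|) * Fintype.card ι ≤ lam / 2)
    {m : ℕ} (k : Fin m → ι → ℝ) (hon : ∀ a a', k a ⬝ᵥ k a' = if a = a' then 1 else 0)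
    (hker : ∀ a, frameHessRaw (L := L) τ
      (ringCoord L (P * multiCurve (dirOf τ u) (dirOf_conjTranspose hτ u) (dirOf_trace hτ0 u) 1)) *ᵥ k a = 0)
    (Bm : ι → Matrix ι ι ℝ) {b : ℝ} (hb : 0 ≤ b) (hB : ∀ i v, (Bm i *ᵥ v) ⬝ᵥ (Bm i *ᵥ v) ≤ b ^ 2 * (v ⬝ᵥ v)) :
    (1 / 2) * Matrix.trace ((frameHess (L := L) τ (ringCoord L P) + lam • (1 : Matrix ι ι ℝ))⁻¹ * frameHess (L := L) τ (ringCoord L P)) -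
        (1 / 2) * ∑ i, ((frameHess (L := L) τ (ringCoord L P) + lam • (1 : Matrix ι ι ℝ))⁻¹ *ᵥ
          (Bm i *ᵥ ((frameHess (L := L) τ (ringCoord L P) + lam • (1 : Matrix ι ι ℝ))⁻¹ *ᵥ frameGrad (L := L) τ (ringCoord L P)))) i ≤
      (1 / 2) * ((Fintype.card ι : ℝ) - m) +
        (1 / 2) * (m * ((K * (∑ j, |u j|) * Fintype.card ι) / (K * (∑ j, |u j|) * Fintype.card ι + lam))) +
        (1 / 2) * ((Fintype.card ι : ℝ) * (b / (lam / 2)) *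
          Real.sqrt (3 * ((1 + lam ^ 2 / (lam / 2) ^ 2) * (u ⬝ᵥ u) +
            (2 * K * (Fintype.card ι : ℝ) * Real.sqrt (Fintype.card ι)) ^ 2 * (u ⬝ᵥ u) ^ 2 / (lam / 2) ^ 2))) := by
  classical
  set ℓ := ∑ j, |u j| with hℓ
  have hℓ0 : 0 ≤ ℓ := Finset.sum_nonneg fun j _ => abs_nonneg _
  set M := ringCoord L P with hM
  set g := frameGrad (L := L) τ M with hg
  set H := frameHess (L := L) τ M with hH
  set r := g + H *ᵥ u with hr
  have hYu : ∀ w, ‖dirOf τ u w‖ ≤ ℓ := fun w => norm_dirOf_le hτn u w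
  have hK1 : ∀ j k' (Q : ((Fin (2 * L - 1 + 1) → GaugeConfig 3 L SU2) × (Site 3 L → SU2))), |frameD (dirOf τ u) (frameD (τ j) (frameD (τ k') (ringPoly L))) (ringCoord L Q)| ≤ K * ℓ := by
    intro j k' Q
    have h := hK3 (dirOf τ u) (τ j) (τ k') ℓ 1 1 hℓ0 zero_le_one zero_le_one hYu (hτn j) (hτn k') Q
    simpa using h
  have hK2 : ∀ k' (Q : ((Fin (2 * L - 1 + 1) → GaugeConfig 3 L SU2) × (Site 3 L → SU2))), |frameD (dirOf τ u) (frameD (dirOf τ u) (frameD (τ k') (ringPoly L))) (ringCoord L Q)| ≤ K * ℓ ^ 2 := by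
    intro k' Q
    have h := hK3 (dirOf τ u) (dirOf τ u) (τ k') ℓ ℓ 1 hℓ0 hℓ0 zero_le_one hYu hYu (hτn k') Q
    calc _ ≤ K * ℓ * ℓ * 1 := h
      _ = K * ℓ ^ 2 := by ring
  have hK3' : ∀ Q : ((Fin (2 * L - 1 + 1) → GaugeConfig 3 L SU2) × (Site 3 L → SU2)), |frameD (dirOf τ u) (frameD (dirOf τ u) (frameD (dirOf τ u) (ringPoly L))) (ringCoord L Q)| ≤ K * ℓ ^ 3 := by
    intro Q
    have h := hK3 (dirOf τ u) (dirOf τ u) (dirOf τ u) ℓ ℓ ℓ hℓ0 hℓ0 hℓ0 hYu hYu hYu Q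
    calc _ ≤ K * ℓ * ℓ * ℓ := h
      _ = K * ℓ ^ 3 := by ring
  obtain ⟨-, hc2, ⟨hsymm, hpsd⟩, hc4⟩ := pointwise_taylor_package hτ hτ0 u P hp hK1 hK2 hK3'
  have hKℓ : 0 ≤ K * ℓ := mul_nonneg hK hℓ0
  set p := P * multiCurve (dirOf τ u) (dirOf_conjTranspose hτ u) (dirOf_trace hτ0 u) 1 with hpdef
  have hHp : frameHess (L := L) τ (ringCoord L p) = frameHessRaw (L := L) τ (ringCoord L p) :=
    frameHess_eq_raw_of_symm τ _ hsymm
  have hdrift : ∀ j k', |H j k' - frameHessRaw (L := L) τ (ringCoord L p) j k'| ≤ K * ℓ := by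
    intro j k'; rw [← hHp]; exact hc4 j k'
  have hfl : ∀ v, (lam / 2) * (v ⬝ᵥ v) ≤ v ⬝ᵥ ((H + lam • (1 : Matrix ι ι ℝ)) *ᵥ v) := by
    intro v
    have h := floor_of_drift (lam := lam) hKℓ hdrift hpsd v
    have hvv : 0 ≤ v ⬝ᵥ v := Finset.sum_nonneg fun i _ => mul_self_nonneg (v i)
    nlinarith
  -- the approximate kernel at `P`
  have hs0 : 0 ≤ K * ℓ * Fintype.card ι := by positivity
  have hker' : ∀ a, k a ⬝ᵥ (H *ᵥ k a) ≤ K * ℓ * Fintype.card ι := fun a =>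
    approxKernel_of_kernel hKℓ hdrift (by simpa using hon a a) (hker a)
  -- Taylor data
  have hHsymm : Hᵀ = H := frameHess_transpose τ M
  have hgr : g = r - H *ᵥ u := by rw [hr]; abel
  set d := Real.sqrt (u ⬝ᵥ u) with hd
  have huu0 : 0 ≤ u ⬝ᵥ u := Finset.sum_nonneg fun i _ => mul_self_nonneg (u i)
  have hd2 : d ^ 2 = u ⬝ᵥ u := Real.sq_sqrt huu0
  have hℓd : ℓ ^ 2 ≤ Fintype.card ι * d ^ 2 := by rw [hd2]; exact sum_abs_sq_le u
  have hrk : ∀ k', |r k'| ≤ 2 * K * ℓ ^ 2 := by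
    intro k'
    calc |r k'| ≤ K * ℓ ^ 2 + K * ℓ * ℓ := hc2 k'
      _ = 2 * K * ℓ ^ 2 := by ring
  have hrr : r ⬝ᵥ r ≤ Fintype.card ι * (2 * K * ℓ ^ 2) ^ 2 := by
    calc r ⬝ᵥ r = ∑ k', r k' * r k' := rfl
      _ ≤ ∑ _k : ι, (2 * K * ℓ ^ 2) ^ 2 := Finset.sum_le_sum fun k' _ => by
          have h := hrk k'
          rw [← sq, ← sq_abs]
          exact pow_le_pow_left₀ (abs_nonneg _) h 2
      _ = Fintype.card ι * (2 * K * ℓ ^ 2) ^ 2 := by simp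
  set Mr : ℝ := 2 * K * (Fintype.card ι : ℝ) * Real.sqrt (Fintype.card ι) with hMr
  have hsq : Real.sqrt (Fintype.card ι) ^ 2 = Fintype.card ι := Real.sq_sqrt (by positivity)
  have hMr2 : Mr ^ 2 = 4 * K ^ 2 * (Fintype.card ι : ℝ) ^ 3 := by
    have : Mr ^ 2 = (2 * K * (Fintype.card ι : ℝ)) ^ 2 * Real.sqrt (Fintype.card ι) ^ 2 := by rw [hMr]; ring
    rw [this, hsq]; ring
  have hrr' : r ⬝ᵥ r ≤ Mr ^ 2 * d ^ 4 := by
    have h2 : (ℓ ^ 2) ^ 2 ≤ (Fintype.card ι * d ^ 2) ^ 2 := pow_le_pow_left₀ (by positivity) hℓd 2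
    calc r ⬝ᵥ r ≤ Fintype.card ι * (2 * K * ℓ ^ 2) ^ 2 := hrr
      _ = Fintype.card ι * (2 * K) ^ 2 * (ℓ ^ 2) ^ 2 := by ring
      _ ≤ Fintype.card ι * (2 * K) ^ 2 * (Fintype.card ι * d ^ 2) ^ 2 := by gcongr
      _ = Mr ^ 2 * d ^ 4 := by rw [hMr2]; ring
  have hdiv := divergence_upper hHsymm hlam (by positivity : (0 : ℝ) < lam / 2) hs0 hb hfl k hon hker' Bm hB hgr
    (le_of_eq hd2.symm) hrr'
  have hd4 : d ^ 4 = (u ⬝ᵥ u) ^ 2 := by rw [← hd2]; ring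
  rw [hd2, hd4] at hdiv
  exact hdiv

end Summit.QuantumFields.YangMills.Theorems.VirialFluxGap.FrameHessian

end
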